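import Mathlib
import Literature.MathematicalPhysics.QuantumLattice.WilsonDiracAP
import Summits.QuantumFields.QCD.Theorems.QuarksAsStableActionWilsonQuarkStabilityStubFreeTwistedFourier
import Summits.QuantumFields.QCD.Theorems.QuarksAsStableActionCriticalLineDiamagnetismStubTadpoleAux

/-!
# The tadpole: exact structure of the linear term of the one-loop block expansion
(helper for crux stmt-QuantumFields-9734, line `Sketch`, stub `stub_tadpole`)

What.  On the `2⁴` block `(ℤ/2)⁴` (colour `Fin 3`, spin `Fin 4`) with constant central link phases
`u_μ = e^{iθ_μ}·1`, let `B⁰ = wilsonDirac ρ₃ (fun e => u e.2) m 1` be the free `r = 1` Wilson–Dirac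
operator and `Δ(E)` the hopping perturbation, ℝ-linear in the matrix-valued link field
`E : Edge 4 2 → M₃(ℂ)` (forward hop `(1 − γ_μ) ⊗ u_μ E(x,μ)`, backward hop
`(1 + γ_μ) ⊗ (u_μ E(y,μ))ᴴ`).  The ℝ-linear functional `ℓ(E) = Re tr (B⁰⁻¹ Δ(E))` depends on `E`
only through the colour traces `S_μ = Σ_x tr E(x,μ)` when these are real:
`ℓ(E) = Σ_μ ℓ(tst_μ) · Re S_μ`, `tst_μ` the test field `(1/3)·1` on the single link `(0, μ)`
(`stub_tadpole`).

How (symmetry, no Fourier analysis; the algebra is in the sibling file `…StubTadpoleAux`).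
* Write `Δ(E) = H(uE, (uE)ᴴ)` and `B⁰ = (m + 4)·1 + H(u, ū)` with the hopping form `H` of the Aux
  file (`ū = e^{−iθ}·1`, `star_exp_smul_one` of `…WilsonQuarkStabilityStubFreeTwistedFourier`);
  `Δ` is additive and ℝ-homogeneous in `E`, so `ℓ` is.
* Block translations `(x,a,α) ↦ (x+t,a,α)` and colour permutations `(x,a,α) ↦ (x,σa,α)` are
  re-indexings `Matrix.submatrix e e` fixing `B⁰` and carrying `Δ(E)` to `Δ(E')` for the
  translated, resp. colour-permuted, field `E'`; real diagonal colour signs `D = diag(±1)` act by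
  conjugation with an involution `P` fixing `B⁰`, `P Δ(E) P = Δ(DED)` (the phases `u_μ` are
  central).  Since `tr ((B.submatrix e e)⁻¹ (D.submatrix e e)) = tr (B⁻¹ D)` and
  `tr ((PBP)⁻¹ (PDP)) = tr (B⁻¹ D)` (nonsingular inverse, no invertibility needed: if `B⁰` is
  singular both sides of the claim are computed with the same junk value), `ℓ` is invariant under
  all three operations on `E`.
* `Tadpole.assembly` (finite averaging over `diag(±1)` and the cyclic colour permutations) then
  gives the claim.

References: Montvay–Münster, *Quantum Fields on a Lattice* §4.2 (Wilson fermions, hopping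
expansion); folklore linear algebra. Pure theorem file (no `def`s).
-/

noncomputable section

open scoped BigOperators Classical Matrix ComplexConjugate
open Finset
open Literature.MathematicalPhysics.QuantumLattice Literature.MathematicalPhysics.QuantumFieldTheory
  Literature.Probability.LatticeModels

namespace Summit.QuantumFields.QCD.Cruxes.CriticalLineDiamagnetism.ChessboardCellGain

open Tadpole Complex in
open Summit.QuantumFields.QCD.Cruxes.WilsonQuarkStability.FreeTangentLandauChessboard
  (star_exp_smul_one) in
/-- **The tadpole** (stub `stub_tadpole`): on the `2⁴` block with constant central phases
`u_μ = e^{iθ_μ}·1`, the ℝ-linear functional `ℓ(E) = Re tr (B⁰⁻¹ Δ(E))` (`B⁰` the free `r = 1`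
Wilson–Dirac operator, `Δ(E)` the hopping perturbation) satisfies `ℓ(E) = Σ_μ ℓ(tst_μ) · Re S_μ`
whenever all colour traces `S_μ = Σ_x tr E(x,μ)` are real, `tst_μ = (1/3)·1` on the link `(0, μ)`.
Proof: translation, colour-permutation and colour-sign invariance of `ℓ` (re-indexing and involutive
conjugation fix `B⁰` and transport `Δ`), then finite averaging (`Tadpole.assembly`). -/
theorem stub_tadpole : ∀ (m : ℝ) (θ : Fin 4 → ℝ) (u : Fin 4 → Matrix.unitaryGroup (Fin 3) ℂ), (∀ μ, ((u μ : Matrix.unitaryGroup (Fin 3) ℂ) : Matrix (Fin 3) (Fin 3) ℂ) = Complex.exp (↑(θ μ) * Complex.I) • (1 : Matrix (Fin 3) (Fin 3) ℂ)) → let B0 : Matrix (TorusSite 4 2 × Fin 3 × Fin 4) (TorusSite 4 2 × Fin 3 × Fin 4) ℂ := wilsonDirac (unitaryFundamentalRep (Fin 3) ℂ) (fun e : Edge 4 2 => u e.2) m 1; let Dl : (Edge 4 2 → Matrix (Fin 3) (Fin 3) ℂ) → Matrix (TorusSite 4 2 × Fin 3 × Fin 4) (TorusSite 4 2 × Fin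 3 × Fin 4) ℂ := fun E => Matrix.of fun p q => -(1 / 2 : ℂ) * ∑ μ : Fin 4, ((if q.1 = Site.shift p.1 μ then ((1 : Matrix (Fin 4) (Fin 4) ℂ) - euclideanGamma μ) p.2.2 q.2.2 * (((u μ : Matrix.unitaryGroup (Fin 3) ℂ) : Matrix (Fin 3) (Fin 3) ℂ) * E (p.1, μ)) p.2.1 q.2.1 else 0) + (if p.1 = Site.shift q.1 μ then ((1 : Matrix (Fin 4) (Fin 4) ℂ) + euclideanGamma μ) p.2.2 q.2.2 * (((u μ : Matrix.unitaryGroup (Fin 3) ℂ) : Matrix (Fin 3) (Fin 3) ℂ) * E (q.1, μ))ᴴ p.2.1 q.2.1 else 0)); let ell : (Edge 4 2 → Matrix (Fin 3) (Fin 3) ℂ) → ℝ := fun E => (B0⁻¹ * Dl E).trace.re; let tst : Fin 4 → (Edge 4 2 → Matrix (Fin 3) (Fin 3) ℂ) := fun μ e => if e = ((0 : TorusSite 4 2), μ) then (1 / 3 : ℂ) • (1 : Matrix (Fin 3) (Fin 3) ℂ) else 0; ∀ E : Edge 4 2 → Matrix (Fin 3) (Fin 3) ℂ, (∀ μ : Fin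 4, (∑ x : TorusSite 4 2, (E (x, μ)).trace).im = 0) → ell E = ∑ μ : Fin 4, ell (tst μ) * (∑ x : TorusSite 4 2, (E (x, μ)).trace).re := by
  intro m θ u hu B0 Dl ell tst E hE
  -- the hopping form `H`: `Δ(E) = H(uE, (uE)ᴴ)`, `B⁰ = (m + 4)·1 + H(u, ū)`
  obtain ⟨H, hH⟩ : ∃ H : (Fin 4 → TorusSite 4 2 → Matrix (Fin 3) (Fin 3) ℂ) →
      (Fin 4 → TorusSite 4 2 → Matrix (Fin 3) (Fin 3) ℂ) →
        Matrix (TorusSite 4 2 × Fin 3 × Fin 4) (TorusSite 4 2 × Fin 3 × Fin 4) ℂ,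
      ∀ Cp Cm, H Cp Cm = Matrix.of fun p q : TorusSite 4 2 × Fin 3 × Fin 4 =>
        -(1 / 2 : ℂ) * ∑ μ : Fin 4,
          ((if q.1 = Literature.MathematicalPhysics.QuantumFieldTheory.Site.shift p.1 μ then
              ((1 : Matrix (Fin 4) (Fin 4) ℂ) - euclideanGamma μ) p.2.2 q.2.2 * Cp μ p.1 p.2.1 q.2.1
            else 0) +
            (if p.1 = Literature.MathematicalPhysics.QuantumFieldTheory.Site.shift q.1 μ then
              ((1 : Matrix (Fin 4) (Fin 4) ℂ) + euclideanGamma μ) p.2.2 q.2.2 * Cm μ q.1 p.2.1 q.2.1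
            else 0)) :=
    ⟨_, fun _ _ => rfl⟩
  have hDl : ∀ E' : Edge 4 2 → Matrix (Fin 3) (Fin 3) ℂ,
      Dl E' = H (fun μ x => (u μ : Matrix (Fin 3) (Fin 3) ℂ) * E' (x, μ))
        (fun μ y => ((u μ : Matrix (Fin 3) (Fin 3) ℂ) * E' (y, μ))ᴴ) := fun E' => by
    rw [hH]
  have hB0 : B0 = ((m + 4 : ℝ) : ℂ) • (1 : Matrix _ _ ℂ) +
      H (fun μ _ => Complex.exp (↑(θ μ) * I) • (1 : Matrix (Fin 3) (Fin 3) ℂ))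
        (fun μ _ => Complex.exp (-(↑(θ μ) * I)) • (1 : Matrix (Fin 3) (Fin 3) ℂ)) := by
    rw [hH]
    ext p q
    simp only [show B0 = wilsonDirac (unitaryFundamentalRep (Fin 3) ℂ) (fun e : Edge 4 2 => u e.2)
      m 1 from rfl, wilsonDirac, Matrix.of_apply, Matrix.add_apply, Matrix.smul_apply,
      Matrix.one_apply, unitaryFundamentalRep_apply, Matrix.UnitaryGroup.inv_val, hu,
      star_exp_smul_one, Complex.ofReal_one, one_smul, smul_eq_mul, mul_ite, mul_one, mul_zero,
      sub_eq_add_neg, neg_mul]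
  have hell : ∀ E' : Edge 4 2 → Matrix (Fin 3) (Fin 3) ℂ, ell E' = (B0⁻¹ * Dl E').trace.re :=
    fun _ => rfl
  -- (1) additivity and ℝ-homogeneity
  have hadd : ∀ E₁ E₂ : Edge 4 2 → Matrix (Fin 3) (Fin 3) ℂ, ell (E₁ + E₂) = ell E₁ + ell E₂ := by
    intro E₁ E₂
    have h1 : (fun μ x => (u μ : Matrix (Fin 3) (Fin 3) ℂ) * (E₁ + E₂) (x, μ)) =
        (fun μ x => (u μ : Matrix (Fin 3) (Fin 3) ℂ) * E₁ (x, μ)) +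
          fun μ x => (u μ : Matrix (Fin 3) (Fin 3) ℂ) * E₂ (x, μ) := by
      funext μ x; simp [Matrix.mul_add]
    have h2 : (fun μ y => ((u μ : Matrix (Fin 3) (Fin 3) ℂ) * (E₁ + E₂) (y, μ))ᴴ) =
        (fun μ y => ((u μ : Matrix (Fin 3) (Fin 3) ℂ) * E₁ (y, μ))ᴴ) +
          fun μ y => ((u μ : Matrix (Fin 3) (Fin 3) ℂ) * E₂ (y, μ))ᴴ := by
      funext μ y; simp [Matrix.mul_add, Matrix.conjTranspose_add]
    rw [hell, hell, hell, hDl, hDl, hDl, h1, h2, hop_add hH, Matrix.mul_add, Matrix.trace_add,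
      Complex.add_re]
  have hsmul : ∀ (r : ℝ) (E' : Edge 4 2 → Matrix (Fin 3) (Fin 3) ℂ),
      ell ((r : ℂ) • E') = r * ell E' := by
    intro r E'
    have h1 : (fun μ x => (u μ : Matrix (Fin 3) (Fin 3) ℂ) * ((r : ℂ) • E') (x, μ)) =
        (r : ℂ) • fun μ x => (u μ : Matrix (Fin 3) (Fin 3) ℂ) * E' (x, μ) := by
      funext μ x; simp
    have h2 : (fun μ y => ((u μ : Matrix (Fin 3) (Fin 3) ℂ) * ((r : ℂ) • E') (y, μ))ᴴ) =
        (r : ℂ) • fun μ y => ((u μ : Matrix (Fin 3) (Fin 3) ℂ) * E' (y, μ))ᴴ := by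
      funext μ y; simp [Matrix.conjTranspose_smul]
    rw [hell, hell, hDl, hDl, h1, h2, hop_smul hH, Matrix.mul_smul, Matrix.trace_smul, smul_eq_mul,
      Complex.re_ofReal_mul]
  -- (2) translation invariance
  have htrans : ∀ (t : TorusSite 4 2) (E' : Edge 4 2 → Matrix (Fin 3) (Fin 3) ℂ),
      ell (fun e => E' (e.1 + t, e.2)) = ell E' := by
    intro t E'
    have hB : B0.submatrix (⇑((Equiv.addRight t).prodCongr (Equiv.refl (Fin 3 × Fin 4))))
        (⇑((Equiv.addRight t).prodCongr (Equiv.refl (Fin 3 × Fin 4)))) = B0 := by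
      rw [hB0]
      simp only [Matrix.submatrix_add, Matrix.submatrix_smul, Pi.add_apply, Pi.smul_apply,
        Matrix.submatrix_one_equiv, hop_submatrix_translate hH]
    have hD : (Dl E').submatrix (⇑((Equiv.addRight t).prodCongr (Equiv.refl (Fin 3 × Fin 4))))
        (⇑((Equiv.addRight t).prodCongr (Equiv.refl (Fin 3 × Fin 4)))) =
        Dl fun e => E' (e.1 + t, e.2) := by
      simp only [hDl]
      rw [hop_submatrix_translate hH]
    simp only [hell]
    rw [← trace_inv_mul_submatrix B0 (Dl E')
      ((Equiv.addRight t).prodCongr (Equiv.refl (Fin 3 × Fin 4))), hB, hD]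
  -- (3) colour-sign invariance
  have hdiag : ∀ d : Fin 3 → ℝ, (∀ a, d a * d a = 1) → ∀ E' : Edge 4 2 → Matrix (Fin 3) (Fin 3) ℂ,
      ell (fun e => Matrix.diagonal (fun a => (d a : ℂ)) * E' e *
        Matrix.diagonal (fun a => (d a : ℂ))) = ell E' := by
    intro d hd E'
    have hd' : ∀ a, ((d a : ℝ) : ℂ) * ((d a : ℝ) : ℂ) = 1 := fun a => by exact_mod_cast hd a
    set P : Matrix (TorusSite 4 2 × Fin 3 × Fin 4) (TorusSite 4 2 × Fin 3 × Fin 4) ℂ :=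
      Matrix.diagonal fun p => ((d p.2.1 : ℝ) : ℂ) with hP
    have hPP : P * P = 1 := by
      rw [hP, Matrix.diagonal_mul_diagonal, ← Matrix.diagonal_one]
      congr 1
      funext p
      exact hd' p.2.1
    have hDD : Matrix.diagonal (fun a => (d a : ℂ)) * Matrix.diagonal (fun a => (d a : ℂ)) = 1 := by
      rw [Matrix.diagonal_mul_diagonal, ← Matrix.diagonal_one]
      congr 1
      funext a
      exact hd' a
    have hDstar : (Matrix.diagonal fun a => (d a : ℂ))ᴴ = Matrix.diagonal fun a => (d a : ℂ) := by
      rw [Matrix.diagonal_conjTranspose]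
      congr 1
      funext a
      simp
    have hB : P * B0 * P = B0 := by
      rw [hB0, Matrix.mul_add, Matrix.add_mul, Matrix.mul_smul, Matrix.mul_one, Matrix.smul_mul,
        hPP, hP, hop_diag_conj hH _ _ fun a => ((d a : ℝ) : ℂ)]
      simp only [Matrix.mul_smul, Matrix.mul_one, Matrix.smul_mul, hDD]
    have hD : P * Dl E' * P = Dl fun e => Matrix.diagonal (fun a => (d a : ℂ)) * E' e *
        Matrix.diagonal (fun a => (d a : ℂ)) := by
      simp only [hDl]
      rw [hP, hop_diag_conj hH _ _ fun a => ((d a : ℝ) : ℂ)]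
      simp only [hu, Matrix.smul_mul, Matrix.one_mul, Matrix.mul_smul, Matrix.conjTranspose_smul,
        Matrix.conjTranspose_mul, hDstar, Matrix.mul_assoc]
    simp only [hell]
    rw [← trace_inv_mul_conj P B0 (Dl E') hPP, hB, hD]
  -- (4) colour-permutation invariance
  have hperm : ∀ (σ : Equiv.Perm (Fin 3)) (E' : Edge 4 2 → Matrix (Fin 3) (Fin 3) ℂ),
      ell (fun e => (E' e).submatrix σ σ) = ell E' := by
    intro σ E'
    have hB : B0.submatrix
        (⇑((Equiv.refl (TorusSite 4 2)).prodCongr (σ.prodCongr (Equiv.refl (Fin 4)))))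
        (⇑((Equiv.refl (TorusSite 4 2)).prodCongr (σ.prodCongr (Equiv.refl (Fin 4))))) = B0 := by
      rw [hB0]
      simp only [Matrix.submatrix_add, Matrix.submatrix_smul, Pi.add_apply, Pi.smul_apply,
        Matrix.submatrix_one_equiv, hop_submatrix_perm hH]
    have hD : (Dl E').submatrix
        (⇑((Equiv.refl (TorusSite 4 2)).prodCongr (σ.prodCongr (Equiv.refl (Fin 4)))))
        (⇑((Equiv.refl (TorusSite 4 2)).prodCongr (σ.prodCongr (Equiv.refl (Fin 4))))) =
        Dl fun e => (E' e).submatrix σ σ := by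
      simp only [hDl]
      rw [hop_submatrix_perm hH]
      simp only [hu, Matrix.smul_mul, Matrix.one_mul, Matrix.submatrix_smul, Pi.smul_apply,
        Matrix.conjTranspose_smul, Matrix.conjTranspose_submatrix]
    simp only [hell]
    rw [← trace_inv_mul_submatrix B0 (Dl E')
      ((Equiv.refl (TorusSite 4 2)).prodCongr (σ.prodCongr (Equiv.refl (Fin 4)))), hB, hD]
  -- (5) assembly
  exact assembly ell hadd hsmul htrans hdiag hperm E hE

end Summit.QuantumFields.QCD.Cruxes.CriticalLineDiamagnetism.ChessboardCellGain

end
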